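import Mathlib
import HarnessLib
import HarnessLib.Audit
import Summits.AtomisticToContinuum.Statement
import Literature.Analysis.FunctionSpaces.TorusMollifier
import Summits.AtomisticToContinuum.HydrodynamicLimit.Theorems.ImplosionDichotomyHsEosLowDensity
import Summits.AtomisticToContinuum.HydrodynamicLimit.Theorems.HeatBathForgettingAssembly
import Literature.Probability.Divergences.FDivergence
import Summits.AtomisticToContinuum.HydrodynamicLimit.Theorems.HeatBathForgettingLocalGibbsConcentration
import HarnessLib.Audit.Status.Attr

/-!
Route: ExpTailStaging

DORMANT since 2026-08-24T16:44:17Z (reconciler: no traction for 6.9 d (last activity item-evidence-added at 2026-08-17T18:24:17Z); parked, not closed — `ledger route dormant route-AtomisticToContinuum-ExpTailStaging --off` to reactivate) — unstaffed, not closed; items shared with open routes are served there. `ledger route dormant <id> --off` reactivates.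

# Route ExpTailStaging — one exponential velocity-moment rate plus a staged Gronwall run Yau's
method at kinetic energy |v|²/2

It suffices to show X = K1 ∧ MFC, fed through the STAGING LEMMA into Yau's entropy form of the
conjunct (shared typed target
RelEntropyVanishing, stmt-0766) and then through the entropy inequality (shared glue EntropyToHydro,
stmt-0769) to the Statement.
K1 = ExpVelocityMomentBound (card yau-exponent-forced-divergence-squeeze-v2, item K1, NEW): along
the DETERMINISTIC hard-sphere flow from
local Gibbs data at reduced density σ < σ₀(profiles), for every horizon T > 0 there are ONE rate κ >
0 and C with
E[(N+1)⁻¹ Σ_i exp(κ|v_i(t)|)] ≤ C for all N ≥ N₀, t ∈ [0,T] — strictly weaker than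
Nachtergaele–Yau's Gaussian cut-off II.1
(HighMomentumCutoff σ / GaussianVelocityTails 4607), strictly stronger than cubic uniform
integrability (EnergyCurrentTails 9235).
MFC = MesoFluxClosure (shared typed target of route HeatBathForgetting, stmt-9450): the mesoscopic
one-block flux closure IN MEAN along the
true law — the ergodic sector, imported unchanged. The card's new lemma is StagedEntropyGronwall
(P2): MFC → K1 → statics → 0766, by running
the truncated relative-entropy Gronwall of NachtergaeleYau2003 §7 on stages of length τ₁ < κ/(slope
per unit cut-off) and restarting each stage
from limsup_N H/N = 0, so that ONE exponential rate — not a Gaussian bound, not a super-exponential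
tail for every rate — closes the cut-off.
Lean: `ExpVelocityMomentBound ∧ MesoFluxClosure`

## Assembly
Pure logic, and it IS the deciding theorem `closes` (glue.lean; sorry-free in Sketch.lean, axioms
propext / Classical.choice / Quot.sound):
StagedEntropyGronwall applied to MesoFluxClosure, ExpVelocityMomentBound and the two statics gives
RelEntropyVanishing; EntropyToHydro turns it
into the UNGUARDED Literature conjecture
`Literature.MathematicalPhysics.KineticTheory.HydrodynamicLimit`, which implies the packing-guarded
sub-problem Statement `HydrodynamicLimit` (root def, re-typed 2026-08-16, p126922) by
`HydrodynamicLimit.of_unguarded` (take any threshold,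
ignore the guard): `closes h₁ h₂ h₃ h₄ h₅ h₆ := HydrodynamicLimit.of_unguarded (h₆ (h₃ h₂ h₁ h₄
h₅))` (rev 2). The route therefore proves MORE
than the conjunct — its Euler-quantified shared items (0766, 9450, 11519) carry no packing guard; a
guarded re-typing (inserting
`(∀ t ∈ Ico 0 T, ∀ x, ρ t x * σ ^ 3 < η₀) →` after the solution hypothesis, ∃ η₀ outermost) is a
cross-route tenure option, not needed for `closes`.

Rationale: WHY THIS LINE. Mechanism (card yau-exponent-forced-divergence-squeeze-v2): scanning the whole
f-divergence family in Yau's method shows the high-momentum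
cut-off is a theorem about the class "track D_f(P_t‖ψ_t), close by ψ_t-statistics" (α<1 blind to
e^(-cN)-rare events; KL has the exponential
conjugate of Varadhan1993EntropyMethods §5; super-KL is pinched at cH^(3/2) by one fast sphere;
polynomial f has no conjugate), so the only
door is an a-priori bound on the TRUE law, and the arithmetic of NachtergaeleYau2003 §7.2
(arXiv:math-ph/0209027 p.19: Gronwall factor
e^(δ⁻¹MT₀), "we need the error term stemming from the high-momentum cutoff to be smaller than
e^(-CM) for any C > 0 … guaranteed by the
Maxwellian bound II.1") fixes its MINIMAL form once the horizon is cut into stages: one rate κ, the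
tail error M³e^(-κM) beating e^(cMτ₁) for
τ₁ < κ/c, each stage restarting from limsup_N H/N = 0 exactly. Imported areas: convex duality /
Orlicz–Young (the squeeze), kinetic theory of
moments — hard-sphere collisions CREATE exactly exponential moments e^(a min(t,1)|v|)
(AlonsoEtAl2013 Thm 1; propagation Thm 2,
GambaPanferovVillani2009, BobylevGambaPanferov2004; N-particle stochastic analogue
MischlerMouhot2012), which is why K1 and not II.1 is the
natural target. What no prior route does: SpeedCapSurgery buys an L∞ cap C√log N (Gaussian-type,
N-dependent bookkeeping); AprioriTailsRattlers
(retired) hunted Gaussian tails; HeatBathForgetting (ClosureToEntropy 9453) and WarmColdDichotomy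
(glue 9699) split the cubic tail off with
cubic UI only, which by HighMomentumCutoffBarrierNarrow caveats (c),(g) handles the truncation step
but NOT the bad-block step (slope δ⁻¹M):
this route supplies the missing rate at the weakest level and the staging that makes one rate
enough; the negatives index (9236, 9238, 9168,
…) is untouched — every Euler-quantified item here carries the t = 0 LLN tie to the local Gibbs
data.

RANKED CRUXES. #0 RelEntropyVanishing (target) — Yau's entropy form of the conjunct (shared typed
target stmt-AtomisticToContinuum-0766, verbatim): for all continuous profiles ∃ σ₀ ∀ σ<σ₀ ∀
classical hs-Euler solutions on [0,T) ∀ flows, the initial local Gibbs laws are probability measures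
and, if their fields converge at t = 0, then ∀ t<T ∃ activity profile a_t whose local Gibbs law
(a_t, u_t, θ_t) concentrates its three empirical fields exponentially around (ρ, ρu, E)(t) and
klDiv(lawAt Φ_N (localGibbs a₀u₀θ₀) t ‖ localGibbs a_t u_t θ_t)/(N+1) → 0. (why it might fail:
entropy production ≥ cN before the first shock for some smooth data (a deterministic focusing mode
invisible to the energy) would kill every relative-entropy route at once.) [Yau1991,
OllaVaradhanYau1993, KipnisLandim1999]
#2 ExpVelocityMomentBound (crux) — K1 of the card — ONE EXPONENTIAL VELOCITY-MOMENT RATE ALONG THE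
DETERMINISTIC FLOW, UNIFORMLY IN N: for continuous profiles a₀, θ₀ > 0, u₀ there is σ₀ > 0 such that
for 0 < σ < σ₀, every horizon T > 0 and every family of hard-sphere flows Φ_N there are κ > 0, C and
N₀ with ∫ (N+1)⁻¹ Σ_i exp(κ |v_i(Φ_N(t) z)|) dλ^N_(σ,a₀,u₀,θ₀)(z) ≤ C for all N ≥ N₀ and t ∈ [0,T].
True at t = 0 (conditionally Gaussian velocities); implied by GaussianVelocityTails (4607) since
e^(κ|v|) ≤ e^(κ²/4c) e^(c|v|²); implies EnergyCurrentTails (9235) with ε(M) = C M³ e^(-κM) (support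
ExpRateGivesCubicUI). [difficulty: open-problem] (why it might fail: dynamical and N-uniform: fast
spheres must keep meeting fresh thermal partners and rattler cages must not store energy; entropy
w.r.t. the invariant Gibbs law is blind to one-particle tails (EntropyBlindToCubicMoments) and
kinetic moment creation is known only through propagation of chaos.) [NachtergaeleYau2003,
AlonsoEtAl2013, GambaPanferovVillani2009, BobylevGambaPanferov2004, MischlerMouhot2012,
OllaVaradhanYau1993]
#3 MesoFluxClosure (crux) — the ergodic sector, imported verbatim as the shared typed target of
route HeatBathForgetting (stmt-AtomisticToContinuum-9450): mesoscopic flux closure IN MEAN at some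
block scale (N+1)^(-α), α ∈ (0,1/3), for the energy and the three momentum conservation laws, along
the true evolution from local Gibbs data, σ < σ₀, t < T — exactly the one-block input Yau's identity
consumes (the microscopic current enters only inside an expectation against the smooth weight ∇λ).
Any mechanism for the Boltzmann-hypothesis sector (heat-bath forgetting, u-Gibbs rigidity,
Mourre–Koopman) may discharge it; this route adds nothing to that sector and says so. [difficulty:
open-problem] (why it might fail: a persistent sub-mesoscopic velocity–position structure of the
deterministic gas (interacting analogue of the free-gas rest-frame heat current,
BoltzmannHypothesisBarrierNarrow kernel (5)) would shift the mean flux away from F(U_h) at leading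
order.) [OllaVaradhanYau1993, Yau1991, KipnisLandim1999, Spohn1991]
#4 StagedEntropyGronwall (crux) — THE STAGING LEMMA (card P2, new; the cheapest and most informative
item to attack first): MesoFluxClosure → ExpVelocityMomentBound → ⟨text of LocalGibbsConcentration
9246, inlined⟩ → ⟨text of HsEosLowDensity 0768, inlined⟩ → RelEntropyVanishing (the two statics are
inlined verbatim because the gate declares supports after cruxes; the support decls feed these
hypotheses by unfolding, checked in Sketch.lean). Proof plan: (i) time-integrated relative-entropy
identity for the Liouville flow against the local Gibbs reference ψ_s built on the Euler solution
(activity a(ρ_s,σ) by the inverse equation of state, HsEosLowDensity), H(t) − H(t_k) = −∫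
E_(f_s)[(∂_s + L) log ψ_s] ds, written through exact empirical-field increments; (ii)
MesoFluxClosure replaces the mean increments by ∫∫ F(U_h)·∇λ at mollified fields, λ frozen on a
finite time grid (freezing error ≤ sup|∇∂_sλ| Δt E N⁻¹Σ|v|³, bounded by K1); (iii) Euler in entropy
variables kills the linear part, leaving E_(f_s)∫∇λ·Ω(U_h, U*) with Ω the quadratic flux remainder;
(iv) TRUNCATE at block energy per particle M²: the tame part is ≤ (c₀θ_max‖∇λ‖_∞ M)·H(s)/N + o_N(1)
by the entropy inequality and a mesoscopic large-deviation bound for dilute local Gibbs laws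
(LocalGibbsConcentration strengthened to scale (N+1)^(-α); filed informal as
MesoPressureFunctional), the slope being linear in M exactly as NachtergaeleYau2003 Lemma 5.1 /
§7.2; the HOT part (blocks with e_h > M²ρ_h) is ≤ C M³ e^(-κM/2) by K1, because a hot block needs
fast particles (energy is additive: slow particles in hot blocks have mass ≤ 8/(7M²) × fast kinetic
energy); (v) STAGING: on [t_k, t_k + τ₁] with τ₁ < κ/(2c₀θ_max sup‖∇λ‖), limsup_N H(t)/N ≤
e^(cM(t−t_k)) [limsup_N H(t_k)/N + C M³ e^(-κM/2)(t − t_k)] for every M, hence 0 by induction over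
finitely many stages (M → ∞ after N → ∞ per stage; H(0) = 0 because the t = 0 LLN pins the Euler
data to the local Gibbs profiles); (vi) the ∃ a clause of 0766 from LocalGibbsConcentration at
profile (a_t, u_t, θ_t). [deps: ExpVelocityMomentBound, MesoFluxClosure, LocalGibbsConcentration,
HsEosLowDensity] [difficulty: L] (why it might fail: needs an entropy-inequality slope LINEAR in the
cut-off M for the hard-sphere currents (collisional transfer included) and a mesoscopic LD bound for
dilute local Gibbs laws with o(N) error; a slope superlinear in M would again demand Gaussian tails;
signed-mean closure at fixed ζ may be too weak.) [NachtergaeleYau2003, OllaVaradhanYau1993, Yau1991,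
KipnisLandim1999, Varadhan1993EntropyMethods, arXiv:math-ph/0209027]
#8 EnergyCurrentTails (support) — (support, rank 8 only so that the gate declares it before
ExpRateGivesCubicUI) shared typed crux stmt-AtomisticToContinuum-9235 of WarmColdDichotomy /
OneFlightGossipEngine (verbatim): uniform integrability of the cubic velocity moment along the
evolution before the first shock. Here it is the NECESSARY SHADOW of K1 (ExpRateGivesCubicUI): its
refutation refutes ExpVelocityMomentBound; by itself it is NOT enough for the printed scheme
(HighMomentumCutoffBarrierNarrow caveat (c): the bad-block step re-introduces the cut-off level M),
which is the point of ranking K1 above it. [difficulty: open-problem] [NachtergaeleYau2003,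
OllaVaradhanYau1993, Spohn1991]
#9 EntropyToHydro (support) — shared glue stmt-AtomisticToContinuum-0769 (verbatim):
RelEntropyVanishing → the conjunct, by the entropy inequality μ(A) ≤ (log 2 + H(μ|λ))/log(1 +
1/λ(A)) with λ(A) ≤ C e^(-(N+1)/C) and H = o(N); lawAt = map (flow t). Stated over the (unguarded)
Literature decl; the deciding theorem post-composes it with `HydrodynamicLimit.of_unguarded` to
conclude the packing-guarded root Statement. [difficulty: provable-now] [KipnisLandim1999,
OllaVaradhanYau1993]
#9 LocalGibbsConcentration (support) — shared statics stmt-AtomisticToContinuum-9246 (= text of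
0767, verbatim): exponential law of large numbers for canonical local Gibbs fields at small σ, laws
probability measures for all N and Φ; third hypothesis of StagedEntropyGronwall (inlined there
verbatim) and of `closes` (reference concentration at profile (a_t,u_t,θ_t) and the ∃ a clause of
0766). [difficulty: M] [Ruelle1969, LebowitzPenrose1964]
#9 HsEosLowDensity (support) — shared statics stmt-AtomisticToContinuum-0768 (verbatim): the
hard-sphere excess free energy is real-analytic on a dilute band with F(0) = 0, F'(0) = 2π/3 and the
canonical limit exists; gives the inverse activity–density map and the smooth pressure used by the
reference ψ_t — fourth hypothesis of StagedEntropyGronwall (inlined there verbatim) and of `closes`.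
[difficulty: M] [Ruelle1969, LebowitzPenrose1964]
#9 ExpRateGivesCubicUI (support) — TAIL LATTICE GLUE (provable now): ExpVelocityMomentBound →
EnergyCurrentTails. Given the profiles take σ₀ from K1; for σ < σ₀, an Euler solution (unused),
flows Φ and t ∈ [0,T) apply K1 with horizon t + 1 to get κ, C, N₀; pointwise |v|³ 𝟙(M < |v|) ≤ g(M)
e^(κ|v|) with g(M) = sup_(r>M) r³e^(-κr) (= M³e^(-κM) for M ≥ 3/κ), so the lintegral is ≤
ofReal(g(M)) · ofReal(C) ≤ ofReal ε for M large (lintegral monotonicity, no measurability needed).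
[difficulty: provable-now] [NachtergaeleYau2003, AlonsoEtAl2013]
#9 OrliczCubicThreshold (support) — SQUEEZE CALCULUS (ii) of the card, negative side, provable now:
for θ, β > 0, the Maxwellian weight integrates exp((γv³)^(1/β) − v²/(2θ)) on (0,∞) for EVERY γ > 0
iff β > 3/2 (β = 3/2 fails for γ^(2/3) ≥ 1/(2θ); β < 3/2 fails for all γ) — the Orlicz conjugate
exp(y^(1/β)) of f = M·(log M)^β closes a cubic observable against a Maxwellian exactly in the
super-KL regime β > 3/2, where the one-fast-sphere pinch takes over (informal DivergenceClassNoGo).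
Documents why no divergence choice removes the need for K1. [difficulty: provable-now]
[Varadhan1993EntropyMethods, NachtergaeleYau2003]
#9 EntropyBlindToCubicMoments (support) — SQUEEZE CALCULUS (v) of the card, provable now: for every
variance θ > 0, entropy budget h > 0 and level K there is a probability measure p on ℝ with klDiv(p
‖ N(0,θ)) ≤ h and ∫|v|³ dp ≥ K (mixture (1−q)N(0,θ) + q·Unif[V,V+1] with q ≍ 2θh/V²: cubic moment ≍
2θhV → ∞). The one-line reason K1 cannot come from relative-entropy bookkeeping against the
invariant Gibbs law and must be a dynamical input. [difficulty: provable-now]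
[Varadhan1993EntropyMethods, KipnisLandim1999]

TWO-LAYER PLAN. Foreseen glued splits (k ≤ 3, depth 1; nothing filed now): StagedEntropyGronwall ⇐
EntropyIdentityWithClosure (steps (i)–(iii): H(t) − H(t_k)
= −∫E∫∇λ·Ω(U_h,U*) + o(N), given MFC + K1) → TruncatedLdStep (step (iv): slope c₀θ_max‖∇λ‖M, hot
part CM³e^(-κM/2), given K1 +
MesoPressureFunctional) → StagedEntropyGronwall (step (v) is two lines). ExpVelocityMomentBound ⇐
EquilibriumExpMoments (invariant canonical law:
trivial calibration) → LocalPovznerTransfer (a pathwise/averaged energy-transfer inequality for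
tagged fast spheres at fixed density, the
Lorentz-gas step) → ExpVelocityMomentBound. MesoFluxClosure is split, if at all, inside
HeatBathForgetting (its owner), never here.

KILL CRITERIA. ¬ExpVelocityMomentBound (a pre-shock witness with P(|v₁(t)| > V) ≥ e^(-o(V))
uniformly in N, e.g. an energy-focusing collision tree of
sub-exponential cost) closes the route `refuted:ExpVelocityMomentBound` — and refutes
GaussianVelocityTails 4607 / HighMomentumCutoff σ with it
(hand the witness to SpeedCapSurgery). ¬EnergyCurrentTails ⇒ ¬K1 by ExpRateGivesCubicUI: same close.
¬MesoFluxClosure closes this route and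
HeatBathForgetting; pivot only if the witness lives on fast particles (then re-file the closure for
κ-TRUNCATED currents, which K1 makes
equivalent). ¬RelEntropyVanishing (entropy production ≥ cN pre-shock) kills every entropy route.
SUPERSEDED, not refuted: if a refuter shows the
entropy-inequality slope can be taken M-INDEPENDENT for hard spheres (so that cubic UI suffices and
ClosureToEntropy 9453 is provable as typed),
K1 is unnecessary — close `superseded --by route-AtomisticToContinuum-HeatBathForgetting`.
Conversely a proof of GaussianVelocityTails (4607/9634)
gives K1 for free and the route reduces to StagedEntropyGronwall + MFC. Shared exposure (not
route-specific): the statics live on the dilute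
band; the Statement is now packing-guarded (re-type p126922, 2026-08-16) but this route's
Euler-quantified items 0766/9450/11519 are still
unguarded (stronger than needed). Should a dense-excursion / implosion-type witness ever refute one
of them ONLY in the regime ρσ³ ≥ η₀, that
is `refuted-misstated`: the repair is the guarded restatement (hypothesis `∀ t ∈ Ico 0 T, ∀ x, ρ t x
* σ ^ 3 < η₀`, ∃ η₀ outermost, and
`closes` then concludes the root def directly), not a pivot of the line.

NOT DECOMPOSED YET. The mesoscopic large-deviation / pressure-functional bound for dilute local
Gibbs laws at scale (N+1)^(-α) (filed informal right after open as
support MesoPressureFunctional; LocalGibbsConcentration is its macroscopic shadow); the exact slope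
constant c₀ (NachtergaeleYau2003 Lemma 5.1
analogue for the hard-sphere kinetic + collisional currents); the inverse activity–density map
a(ρ,σ) (inside HsEosLowDensity's band); the
time-grid/freezing bookkeeping of step (ii); the negative-side pinch lemma (one fast sphere: sup
over D_g-balls injects ≥ ‖∇β‖(2θ)^(3/2)
D^(3/(2β)) ≥ cH^(3/2)), filed informal as DivergenceClassNoGo pending the definition request fDiv;
the card's class-completeness clause K2
(universally quantified over closures — a barrier-file matter, not an item); conserved-Rényi
transfer (card bonus, not load-bearing).

CHEAPEST FALSIFIER. The staging arithmetic itself: with NY's bound lim s ≤ Cδ⁻¹MT₀e^(δ⁻¹MT₀ − cM²)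
(arXiv:math-ph/0209027 p.19) replace cM² by κM — does
e^(δ⁻¹Mτ − κM) → 0 per stage and does the restart from limsup H/N = 0 close the induction? Checked
by hand (yes: τ < κδ; the identity
restarts at any t_k because H(f_t|ψ_t) = H(f_(t_k)) − E log ψ_t is an identity for the Liouville
flow) and numerically
(compute/squeeze_check.py in the planner folder, plain python: sup_M e^(cMτ)M³e^(-κM) at c=1, κ=2 is
1.7e-6 (M=50) → 9e-27 (M=150) for τ=1.5
but 9e15 → 1.3e39 for τ=2.5; card numerics reproduced: log f*(y)/y^(1/β) = 1.017 (β=1.5, y=10³),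
1.027 (1.6), 1.099 (2.0); 3/β < 2 iff
β > 1.5; mixture D_0.9 = 0.94 at cN = 50 and 500 while KL = 4.7 → 49.7). Next cheapest: prove/refute
the three provable-now supports in Lean
(OrliczCubicThreshold, EntropyBlindToCubicMoments, ExpRateGivesCubicUI); a refuter finding a printed
|p|²/2 relative-entropy derivation with an
exponential-rate cut-off would downgrade novelty, not truth (searched: none).

NUMBERS. NachtergaeleYau2003 §7 Thm 7.1 / §7.2 (arXiv:math-ph/0209027 pp.18–19): s(γ_t|ω_t) ≤
δ⁻¹Mε∫₀ᵗ s + Ce^(-cM²); Gronwall factor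
δ⁻¹MT₀e^(δ⁻¹MT₀); "smaller than e^(-CM) for any C > 0". Staging: stage length τ₁ < κδ (NY units) =
κ/(2c₀θ_max sup_(s≤t)‖∇λ_s‖_∞) here;
number of stages ⌈t/τ₁⌉ < ∞ pre-shock. Tail lattice: Gaussian ⇒ K1 (e^(κ|v|) ≤ e^(κ²/4c)e^(c|v|²));
K1 ⇒ cubic UI with ε(M) = CM³e^(-κM),
M ≥ 3/κ; cubic UI ⇒ nothing at the bad-block step. Kinetic calibration: ∫ f(t,v)
exp(a·min(t,1)|v|^β) dv ≤ C with β = 1 for hard spheres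
(AlonsoEtAl2013 Thm 1, creation; Thm 2 propagation for s ∈ [β,2]). Orlicz threshold β = 3/2 (3/β <
2). Items at open: 12 typed (3 cruxes,
1 target, 7 supports, 1 assembly) + 2 informal supports filed after open.

DEFINITION REQUESTS. `fDiv` (f-divergence D_f(μ‖ν) = ∫ f(dμ/dν) dν + f'(∞)·μ_⊥(univ) for convex f,
on `MeasureTheory.Measure α`; Mathlib has only
`InformationTheory.klDiv`; `lean search` for fDiv/renyiDiv/hellingerDiv: no matches) in
Literature/Probability — needed only for the
negative-side support DivergenceClassNoGo (the pinch), not on the deciding path; filed with `--for`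
this route after open. No cite facts wanted:
every load-bearing unproved statement is a route item (K1, MFC), never a Literature hypothesis.

Novelty: Searches (2026-08-15): `lit search --hybrid "relative entropy method hydrodynamic limit high
momentum cutoff exponential velocity moments Euler"`
(12 held books: KipnisLandim1999 pp.118/130/186, DeMasiPresutti1991, Cercignani–Illner–Pulvirenti —
KL-with-Gaussian only); `lit search --source
arxiv "exponential moments Boltzmann equation hard spheres"` (7, kinetic level only); `lit galaxy
search "high-momentum cutoff" --star all` (30
rows, QFT noise, 0 hydrodynamic); `lit galaxy search "exponential moments in the Boltzmann equation"
--star pdf` (3: Taskovic–Alonso–Gamba–Pavlovic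
Mittag-Leffler moments, Imbert–Mouhot–Silvestre, OWR 56/2017 — kinetic); `lit galaxy search
"Hydrodynamical limit for a Hamiltonian system with
weak noise" --star all` (11: Fritz elastodynamics, Xu, Liverani–Olla, Olla–Simon chains;
SaintRaymond2009; Varadhan collected papers — all
evasions (ii)/(vi) of the narrow barrier, none with |p|²/2 + convected energy); `lit read
arxiv:math-ph/0209027 --grep` (p.19 L148 quote
verified) and `lit read arxiv:1203.2364` (Thms 1–2 read); one `lit search --source all` rc 75 and
OpenAlex 429 recorded, not retried into a
claim; in-hub: all 21 open route files of the sub,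
RelEntropyErgodic/KineticEnergySurgery/SpeedCapSurgery/HeatBathForgetting/WarmColdDichotomy read,
`ledger negatives` (6, none touched), barrier files HighMomentumCutoff(+Narrow) read in full.
Nearest prior art found: NachtergaeleYau2003 §2.3 II.1 + §7.2 (Gaussian cut-off, one-shot Gronwall,
"no proof … ev  [refs: math-ph/0209027, 1203.2364, arxiv:math-ph/0209027, arxiv:1203.2364, KipnisLandim1999, SaintRaymond2009, NachtergaeleYau2003, OllaVaradhanYau1993, AlonsoEtAl2013]

Barriers (technique_class: relative-entropy, staged-gronwall, exp-moments, f-div-scan): - technique_class: relative-entropy, staged-gronwall, exp-moments, f-div-scan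
- Literature.Barriers.AtomisticToContinuum.HighMomentumCutoffBarrier: it does not evade it; the bet
IS its evasion (iii)/(v) made minimal — the open a-priori input is bought as the route's rank-2 crux
K1, weaker than the barrier's own `HighMomentumCutoff σ` (Gaussian), and StagedEntropyGronwall is
the lemma making the weaker input sufficient; the kinetic energy stays |v|²/2 (no OVY-class
surgery).
- Literature.Barriers.AtomisticToContinuum.HighMomentumCutoffBarrierNarrow: engaged head-on and
SHARPENED: its `blocks` line names as minimal usable form "super-exponential tails sup
E[(N+1)⁻¹Σe^(a|v_i|)] < ∞ for every a"; staging lowers this to ONE a = κ > 0 (caveat (c) is exactly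
the δ⁻¹M slope the stages absorb); caveats (c),(g) are why EnergyCurrentTails is ranked as a support
shadow and not as the door.
- Literature.Barriers.AtomisticToContinuum.BoltzmannHypothesisBarrierNarrow: not evaded and not
advanced — the one-block input is imported whole as MesoFluxClosure (9450), the typed finite-N
currency of that sector; the route is orthogonal to it and says so (a refutation there closes this
route too).
- Literature.Barriers.AtomisticToContinuum.BoltzmannHypothesisBarrier: same barrier, superseded
class line; its free-flight kernel is not a hard-sphere flow at σ > 0 and MesoFluxClosure quantifies
over the conjunct's flows only.
- Literature.Barriers.AtomisticToContinuum.NonAttractiveSystemsBarrier: outsid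

History (route lifecycle, newest last):
- 2026-08-24T16:44:17Z · DORMANT — reconciler: no traction for 6.9 d (last activity item-evidence-added at 2026-08-17T18:24:17Z); parked, not closed — `ledger route dormant route-AtomisticToConti (operator:999:803381)

sub-problem: HydrodynamicLimit · status: dormant · opened planner-plancard-AtomisticToContinuum-Hydrody-53d8ee22-0 2026-08-15T18:17:55Z · rev 3 · ledger route-AtomisticToContinuum-ExpTailStaging
GENERATED by the gate from the ledger (D-0016/17). Provers cite these decls: `theorem foo : Summit.AtomisticToContinuum.HydrodynamicLimit.Theses.ExpTailStaging.<Decl> := …` in Summits/AtomisticToContinuum/HydrodynamicLimit/Theorems/<Name>.lean.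
-/

namespace Summit.AtomisticToContinuum.HydrodynamicLimit.Theses.ExpTailStaging

open scoped BigOperators Topology Manifold Classical MeasureTheory ProbabilityTheory Matrix InnerProductSpace ComplexConjugate ContinuousMap
open Filter Set Function TopologicalSpace MeasureTheory

attribute [summit_statement] _root_.HydrodynamicLimit

/-- item stmt-AtomisticToContinuum-0766 · target · rank 0 · open · by planner
why it might fail: entropy production ≥ cN before the first shock for some smooth data (a deterministic focusing mode invisible to the energy) kills every relative-entropy route at once; as typed ∀T covers solutions whose density exits the dilute EOS band, where no activity profile a_t with exponential LLN may exist.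
sources: Yau1991, OllaVaradhanYau1993, KipnisLandim1999, NachtergaeleYau2003
[target] X_RE: for all continuous profiles ∃ σ₀ ∀ σ<σ₀ ∀ classical hs-Euler solutions on [0,T) ∀
flows: the initial local Gibbs laws are probability measures and, if their fields converge at t=0,
then ∀ t<T ∃ activity profile a_t such that the reference local Gibbs law (a_t, u_t, θ_t) is a
probability measure whose empirical density/momentum/energy fields concentrate exponentially (≤ C
e^{-(N+1)/C}) around (ρ,ρu,E)(t), and klDiv(lawAt Φ_N (localGibbs a₀u₀θ₀) t ‖ localGibbs a_t u_t
θ_t)/(N+1) → 0. Yau1991; OllaVaradhanYau1993 Thm 1.1 (with noise). -/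
@[route_item "route-AtomisticToContinuum-ExpTailStaging"]
def RelEntropyVanishing : Prop :=
  ∀ (a₀ θ₀ : Literature.MathematicalPhysics.KineticTheory.T3 → ℝ) (u₀ : Literature.MathematicalPhysics.KineticTheory.T3 → Literature.MathematicalPhysics.KineticTheory.V3), Continuous a₀ → Continuous θ₀ → Continuous u₀ → (∀ x, 0 < a₀ x) → (∀ x, 0 < θ₀ x) → ∃ σ₀ : ℝ, 0 < σ₀ ∧ ∀ σ : ℝ, 0 < σ → σ < σ₀ → ∀ (T : ℝ) (ρ θ : ℝ → Literature.MathematicalPhysics.KineticTheory.T3 → ℝ) (u : ℝ → Literature.MathematicalPhysics.KineticTheory.T3 → Literature.MathematicalPhysics.KineticTheory.V3), Literature.MathematicalPhysics.KineticTheory.IsHardSphereEulerSolution σ T ρ u θ → ∀ Φ : (N : ℕ) → Literature.Analysis.FluidPDE.HardSphereFlow (Literature.Analysis.FluidPDE.Torus.geometry (Fin 3)) (Literature.MathematicalPhysics.KineticTheory.hsDiameter σ N) (N + 1), (∀ N, MeasureTheory.IsProbabilityMeasure (Literature.MathematicalPhysics.KineticTheory.localGibbsLaw σ a₀ u₀ θ₀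 N (Φ N))) ∧ (Literature.MathematicalPhysics.KineticTheory.TendstoHydroFieldsAt (fun N => Literature.MathematicalPhysics.KineticTheory.localGibbsLaw σ a₀ u₀ θ₀ N (Φ N)) Φ ρ u θ 0 → ∀ t ∈ Set.Ico 0 T, ∃ a : Literature.MathematicalPhysics.KineticTheory.T3 → ℝ, (∀ N, MeasureTheory.IsProbabilityMeasure (Literature.MathematicalPhysics.KineticTheory.localGibbsLaw σ a (u t) (θ t) N (Φ N))) ∧ (∀ χ : Literature.MathematicalPhysics.KineticTheory.T3 → ℝ, Continuous χ → ∀ δ : ℝ, 0 < δ → ∃ C : ℝ, 0 < C ∧ ∀ N : ℕ, Literature.MathematicalPhysics.KineticTheory.localGibbsLaw σ a (u t) (θ t) N (Φ N) {z | δ < |Literature.MathematicalPhysics.KineticTheory.empiricalDensityField z χ - ∫ x, χ x * ρ t x|} ≤ ENNReal.ofReal (C * Real.exp (-(C⁻¹ * (N + 1)))) ∧ Literature.MathematicalPhysics.KineticTheory.localGibbsLaw σ a (u t) (θ t) N (Φ N) {z | δ < ‖Literature.MathematicalPhysics.KineticTheory.empiricalMomentumField z χ - ∫ x, (χ x * ρ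 t x) • u t x‖} ≤ ENNReal.ofReal (C * Real.exp (-(C⁻¹ * (N + 1)))) ∧ Literature.MathematicalPhysics.KineticTheory.localGibbsLaw σ a (u t) (θ t) N (Φ N) {z | δ < |Literature.MathematicalPhysics.KineticTheory.empiricalEnergyField z χ - ∫ x, χ x * Literature.MathematicalPhysics.KineticTheory.totalEnergyDensity (ρ t x) (u t x) (θ t x)|} ≤ ENNReal.ofReal (C * Real.exp (-(C⁻¹ * (N + 1))))) ∧ Filter.Tendsto (fun N : ℕ => InformationTheory.klDiv ((Φ N).lawAt (Literature.MathematicalPhysics.KineticTheory.localGibbsLaw σ a₀ u₀ θ₀ N (Φ N)) t) (Literature.MathematicalPhysics.KineticTheory.localGibbsLaw σ a (u t) (θ t) N (Φ N)) / ((N : ENNReal) + 1)) Filter.atTop (nhds 0))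

/-- item stmt-AtomisticToContinuum-11518 · crux · rank 2 · open · by planner
why it might fail: N-uniform and dynamical: H(f_t|Gibbs)=O(N) is blind to one-particle tails below |v|~√N; exp-moment creation is proved only for Boltzmann/Kac (AlonsoEtAl2013, MischlerMouhot2012), not the fixed-σ deterministic flow; an energy-focusing collision tree of sub-exponential cost gives P(|v₁(t)|>V)≥e^-o(V).
sources: NachtergaeleYau2003, AlonsoEtAl2013, MischlerMouhot2012, GambaPanferovVillani2009, BobylevGambaPanferov2004, OllaVaradhanYau1993
[crux] K1 of the card — ONE EXPONENTIAL VELOCITY-MOMENT RATE ALONG THE DETERMINISTIC FLOW, UNIFORMLY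
IN N: for continuous profiles a₀, θ₀ > 0, u₀ there is σ₀ > 0 such that for 0 < σ < σ₀, every horizon
T > 0 and every family of hard-sphere flows Φ_N there are κ > 0, C and N₀ with ∫ (N+1)⁻¹ Σ_i exp(κ
|v_i(Φ_N(t) z)|) dλ^N_(σ,a₀,u₀,θ₀)(z) ≤ C for all N ≥ N₀ and t ∈ [0,T]. True at t = 0 (conditionally
Gaussian velocities); implied by GaussianVelocityTails (4607) since e^(κ|v|) ≤ e^(κ²/4c) e^(c|v|²);
implies EnergyCurrentTails (9235) with ε(M) = C M³ e^(-κM) (support ExpRateGivesCubicUI).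
[difficulty: open-problem] -/
@[route_item "route-AtomisticToContinuum-ExpTailStaging", crux]
def ExpVelocityMomentBound : Prop :=
  ∀ (a₀ θ₀ : Literature.MathematicalPhysics.KineticTheory.T3 → ℝ) (u₀ : Literature.MathematicalPhysics.KineticTheory.T3 → Literature.MathematicalPhysics.KineticTheory.V3), Continuous a₀ → Continuous θ₀ → Continuous u₀ → (∀ x, 0 < a₀ x) → (∀ x, 0 < θ₀ x) → ∃ σ₀ : ℝ, 0 < σ₀ ∧ ∀ σ : ℝ, 0 < σ → σ < σ₀ → ∀ T : ℝ, 0 < T → ∀ Φ : (N : ℕ) → Literature.Analysis.FluidPDE.HardSphereFlow (Literature.Analysis.FluidPDE.Torus.geometry (Fin 3)) (Literature.MathematicalPhysics.KineticTheory.hsDiameter σ N) (N + 1), ∃ κ : ℝ, 0 < κ ∧ ∃ C : ℝ, ∃ N₀ : ℕ, ∀ N : ℕ, N₀ ≤ N → ∀ t ∈ Set.Icc 0 T, ∫⁻ z, ENNReal.ofReal (((N : ℝ) + 1)⁻¹ * ∑ i : Fin (N + 1), Real.exp (κ * ‖((Φ N).flow t z i).2‖)) ∂(Literature.MathematicalPhysics.KineticTheory.localGibbsLaw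 σ a₀ u₀ θ₀ N (Φ N)) ≤ ENNReal.ofReal C

/-- item stmt-AtomisticToContinuum-9450 · crux · rank 3 · open · by planner
why it might fail: The local-equilibrium (Boltzmann-hypothesis) step for DETERMINISTIC hard spheres at fixed σ: OVY93 need velocity noise exactly here, no substitute known (only the dilute iterated limit, DengHaniMa2024, or d=1); a persistent sub-mesoscopic velocity–position correlation shifts the mean flux off F(U).
sources: OllaVaradhanYau1993, Yau1991, Spohn1991, KipnisLandim1999, NachtergaeleYau2003, DengHaniMa2024
[target] X of § Thesis — mesoscopic flux closure in mean at some block scale (N+1)^(-α), α ∈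
(0,1/3), for the energy and the three momentum conservation laws, along the true evolution from
local Gibbs data, σ < σ₀, t < T. -/
@[route_item "route-AtomisticToContinuum-ExpTailStaging", crux]
def MesoFluxClosure : Prop :=
  ∀ (a₀ θ₀ : Literature.MathematicalPhysics.KineticTheory.T3 → ℝ) (u₀ : Literature.MathematicalPhysics.KineticTheory.T3 → Literature.MathematicalPhysics.KineticTheory.V3), Continuous a₀ → Continuous θ₀ → Continuous u₀ → (∀ x, 0 < a₀ x) → (∀ x, 0 < θ₀ x) → ∃ σ₀ : ℝ, 0 < σ₀ ∧ ∀ σ : ℝ, 0 < σ → σ < σ₀ → ∀ (T : ℝ) (ρ θ : ℝ → Literature.MathematicalPhysics.KineticTheory.T3 → ℝ) (u : ℝ → Literature.MathematicalPhysics.KineticTheory.T3 → Literature.MathematicalPhysics.KineticTheory.V3), Literature.MathematicalPhysics.KineticTheory.IsHardSphereEulerSolution σ T ρ u θ → ∀ Φ : (N : ℕ) → Literature.Analysis.FluidPDE.HardSphereFlow (Literature.Analysis.FluidPDE.Torus.geometry (Fin 3)) (Literature.MathematicalPhysics.KineticTheory.hsDiameter σ N) (N + 1), Literature.MathematicalPhysics.KineticTheory.TendstoHydroFieldsAt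 (fun N => Literature.MathematicalPhysics.KineticTheory.localGibbsLaw σ a₀ u₀ θ₀ N (Φ N)) Φ ρ u θ 0 → ∃ α : ℝ, 0 < α ∧ α < 1 / 3 ∧ ∀ t ∈ Set.Ico 0 T, ∀ t₁ t₂ : ℝ, 0 ≤ t₁ → t₁ ≤ t₂ → t₂ ≤ t → ∀ ζ : Literature.MathematicalPhysics.KineticTheory.T3 → ℝ, Literature.Analysis.FunctionSpaces.Torus.IsSmooth ζ → ∀ δ : ℝ, 0 < δ → ∃ N₀ : ℕ, ∀ N : ℕ, N₀ ≤ N → (let h : ℝ := ((N + 1 : ℕ) : ℝ) ^ (-α); let P := Literature.MathematicalPhysics.KineticTheory.localGibbsLaw σ a₀ u₀ θ₀ N (Φ N); let ρb := fun (w : Literature.Analysis.FluidPDE.Config (N + 1) (Fin 3) Literature.MathematicalPhysics.KineticTheory.T3) (x : Literature.MathematicalPhysics.KineticTheory.T3) => Literature.MathematicalPhysics.KineticTheory.empiricalDensityField w (fun y => Literature.Analysis.FunctionSpaces.Torus.kernel h (y - x)); let mb := fun (w : Literature.Analysis.FluidPDE.Config (N + 1) (Fin 3) Literature.MathematicalPhysics.KineticTheory.T3)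 (x : Literature.MathematicalPhysics.KineticTheory.T3) => Literature.MathematicalPhysics.KineticTheory.empiricalMomentumField w (fun y => Literature.Analysis.FunctionSpaces.Torus.kernel h (y - x)); let eb := fun (w : Literature.Analysis.FluidPDE.Config (N + 1) (Fin 3) Literature.MathematicalPhysics.KineticTheory.T3) (x : Literature.MathematicalPhysics.KineticTheory.T3) => Literature.MathematicalPhysics.KineticTheory.empiricalEnergyField w (fun y => Literature.Analysis.FunctionSpaces.Torus.kernel h (y - x)); let pb := fun (w : Literature.Analysis.FluidPDE.Config (N + 1) (Fin 3) Literature.MathematicalPhysics.KineticTheory.T3) (x : Literature.MathematicalPhysics.KineticTheory.T3) => Literature.MathematicalPhysics.KineticTheory.hsPressure σ (ρb w x) (2 / 3 * (eb w x / ρb w x - ‖mb w x‖ ^ 2 / (2 * ρb w x ^ 2))); let mg := fun (w : Literature.Analysis.FluidPDE.Config (N + 1) (Fin 3) Literature.MathematicalPhysics.KineticTheory.T3) (x : Literature.MathematicalPhysics.KineticTheory.T3) => ∑ j : Fin 3, mb w x j * Literature.Analysis.FunctionSpaces.Torus.partialDeriv j ζ x; let Den := fun (z : Literature.Analysis.FluidPDE.Config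 (N + 1) (Fin 3) Literature.MathematicalPhysics.KineticTheory.T3) => Literature.MathematicalPhysics.KineticTheory.empiricalEnergyField ((Φ N).flow t₂ z) ζ - Literature.MathematicalPhysics.KineticTheory.empiricalEnergyField ((Φ N).flow t₁ z) ζ - ∫ s in Set.Icc t₁ t₂, ∫ x : Literature.MathematicalPhysics.KineticTheory.T3, (eb ((Φ N).flow s z) x + pb ((Φ N).flow s z) x) / ρb ((Φ N).flow s z) x * mg ((Φ N).flow s z) x; let Dmo := fun (k : Fin 3) (z : Literature.Analysis.FluidPDE.Config (N + 1) (Fin 3) Literature.MathematicalPhysics.KineticTheory.T3) => Literature.MathematicalPhysics.KineticTheory.empiricalMomentumField ((Φ N).flow t₂ z) ζ k - Literature.MathematicalPhysics.KineticTheory.empiricalMomentumField ((Φ N).flow t₁ z) ζ k - ∫ s in Set.Icc t₁ t₂, ∫ x : Literature.MathematicalPhysics.KineticTheory.T3, (mg ((Φ N).flow s z) x * mb ((Φ N).flow s z) x k / ρb ((Φ N).flow s z) x + pb ((Φ N).flow s z) x * Literature.Analysis.FunctionSpaces.Torus.partialDeriv k ζ x); (MeasureTheory.Integrable Den P ∧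 |∫ z, Den z ∂P| ≤ δ) ∧ ∀ k : Fin 3, MeasureTheory.Integrable (Dmo k) P ∧ |∫ z, Dmo k z ∂P| ≤ δ)

/-- item stmt-AtomisticToContinuum-11519 · crux · rank 4 · open · by planner
why it might fail: Unprinted for hard spheres: needs a local-Gibbs LD slope LINEAR in cut-off M for currents with collisional transfer plus a block-scale cluster-expansion LD bound; superlinear slope re-demands Gaussian tails (NY03 §7.2); mean closure at fixed ζ may not freeze along λ(s,·); ∀T lets ρ exit dilute band.
sources: NachtergaeleYau2003, arXiv:math-ph/0209027, OllaVaradhanYau1993, Yau1991, Varadhan1993EntropyMethods, KipnisLandim1999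
[crux] THE STAGING LEMMA (card P2, new; the cheapest and most informative item to attack first):
MesoFluxClosure → ExpVelocityMomentBound → ⟨text of LocalGibbsConcentration 9246, inlined⟩ → ⟨text
of HsEosLowDensity 0768, inlined⟩ → RelEntropyVanishing (the two statics are inlined verbatim
because the gate declares supports after cruxes; the support decls feed these hypotheses by
unfolding, checked in Sketch.lean). Proof plan: (i) time-integrated relative-entropy identity for
the Liouville flow against the local Gibbs reference ψ_s built on the Euler solution (activity
a(ρ_s,σ) by the inverse equation of state, HsEosLowDensity), H(t) − H(t_k) = −∫ E_(f_s)[(∂_s + L)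
log ψ_s] ds, written through exact empirical-field increments; (ii) MesoFluxClosure replaces the
mean increments by ∫∫ F(U_h)·∇λ at mollified fields, λ frozen on a finite time grid (freezing error
≤ sup|∇∂_sλ| Δt E N⁻¹Σ|v|³, bounded by K1); (iii) Euler in entropy variables kills the linear part,
leaving E_(f_s)∫∇λ·Ω(U_h, U*) with Ω the quadratic flux remainder; (iv) TRUNCATE at block energy per
particle M²: the tame part is ≤ (c₀θ_max‖∇λ‖_∞ M)·H(s)/N + o_N(1) by the entropy inequality and a
mesoscopic large-deviation boun -/
@[route_item "route-AtomisticToContinuum-ExpTailStaging", crux]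
def StagedEntropyGronwall : Prop :=
  MesoFluxClosure → ExpVelocityMomentBound → (∀ (a θ₀ : Literature.MathematicalPhysics.KineticTheory.T3 → ℝ) (u₀ : Literature.MathematicalPhysics.KineticTheory.T3 → Literature.MathematicalPhysics.KineticTheory.V3), Continuous a → Continuous θ₀ → Continuous u₀ → (∀ x, 0 < a x) → (∀ x, 0 < θ₀ x) → ∃ σ₀ : ℝ, 0 < σ₀ ∧ ∀ σ : ℝ, 0 < σ → σ < σ₀ → ∃ ρ₀ : Literature.MathematicalPhysics.KineticTheory.T3 → ℝ, Continuous ρ₀ ∧ (∀ x, 0 < ρ₀ x) ∧ (∀ (N : ℕ) (Φ : Literature.Analysis.FluidPDE.HardSphereFlow (Literature.Analysis.FluidPDE.Torus.geometry (Fin 3)) (Literature.MathematicalPhysics.KineticTheory.hsDiameter σ N) (N + 1)), MeasureTheory.IsProbabilityMeasure (Literature.MathematicalPhysics.KineticTheory.localGibbsLaw σ a u₀ θ₀ N Φ)) ∧ ∀ χ : Literature.MathematicalPhysics.KineticTheory.T3 → ℝ, Continuous χ → ∀ δ : ℝ, 0 < δ → ∃ C : ℝ, 0 < C ∧ ∀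 (N : ℕ) (Φ : Literature.Analysis.FluidPDE.HardSphereFlow (Literature.Analysis.FluidPDE.Torus.geometry (Fin 3)) (Literature.MathematicalPhysics.KineticTheory.hsDiameter σ N) (N + 1)), Literature.MathematicalPhysics.KineticTheory.localGibbsLaw σ a u₀ θ₀ N Φ {z | δ < |Literature.MathematicalPhysics.KineticTheory.empiricalDensityField z χ - ∫ x, χ x * ρ₀ x|} ≤ ENNReal.ofReal (C * Real.exp (-(C⁻¹ * (N + 1)))) ∧ Literature.MathematicalPhysics.KineticTheory.localGibbsLaw σ a u₀ θ₀ N Φ {z | δ < ‖Literature.MathematicalPhysics.KineticTheory.empiricalMomentumField z χ - ∫ x, (χ x * ρ₀ x) • u₀ x‖} ≤ ENNReal.ofReal (C * Real.exp (-(C⁻¹ * (N + 1)))) ∧ Literature.MathematicalPhysics.KineticTheory.localGibbsLaw σ a u₀ θ₀ N Φ {z | δ < |Literature.MathematicalPhysics.KineticTheory.empiricalEnergyField z χ - ∫ x, χ x * Literature.MathematicalPhysics.KineticTheory.totalEnergyDensity (ρ₀ x) (u₀ x) (θ₀ x)|} ≤ ENNReal.ofReal (C * Real.exp (-(C⁻¹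 * (N + 1))))) → (∃ η₀ : ℝ, 0 < η₀ ∧ ∃ F : ℝ → ℝ, AnalyticOnNhd ℝ F (Set.Ioo (-η₀) η₀) ∧ Set.EqOn Literature.MathematicalPhysics.KineticTheory.hsExcessFreeEnergy F (Set.Ico 0 η₀) ∧ F 0 = 0 ∧ deriv F 0 = 2 * Real.pi / 3 ∧ ∀ η ∈ Set.Ico 0 η₀, Filter.Tendsto (fun N : ℕ => -(N : ℝ)⁻¹ * Real.log (Literature.MathematicalPhysics.KineticTheory.hsFreeVolume η N)) Filter.atTop (nhds (F η))) → RelEntropyVanishing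

/-- item stmt-AtomisticToContinuum-9235 · support · rank 8 · open · by planner
sources: NachtergaeleYau2003, OllaVaradhanYau1993, Spohn1991
[crux] UNIFORM INTEGRABILITY OF THE CUBIC ENERGY CURRENT BEFORE THE FIRST SHOCK (shared typed crux
stmt-AtomisticToContinuum-3655 of route KineticWindows; the card's "cubic UI" conjunct X_T): for
continuous profiles ∃ σ₀ ∀ σ ∈ (0,σ₀) ∀ classical hs-Euler solutions on [0,T) ∀ flow families, if
the local Gibbs fields converge at t = 0 then ∀ t < T ∀ ε > 0 ∃ M ∃ N₀ ∀ N ≥ N₀ ∀ s ∈ [0,t]: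
E[(N+1)⁻¹ Σ_i |v_i(s)|³ 1{|v_i(s)| > M}] ≤ ε. Needed here only for the energy equation (heat flux
and (E+p)u): the quadratic momentum closure needs no tail input in this route (energy conservation +
the o(N) entropy bootstrap exclude sparse energy concentration, whose local-Gibbs cost is
extensive), but cubic mass on a vanishing fraction of particles has SUB-extensive cost. [difficulty:
open-problem] -/
@[route_item "route-AtomisticToContinuum-ExpTailStaging"]
def EnergyCurrentTails : Prop :=
  ∀ (a₀ θ₀ : Literature.MathematicalPhysics.KineticTheory.T3 → ℝ) (u₀ : Literature.MathematicalPhysics.KineticTheory.T3 → Literature.MathematicalPhysics.KineticTheory.V3), Continuous a₀ → Continuous θ₀ → Continuous u₀ → (∀ x, 0 < a₀ x) → (∀ x, 0 < θ₀ x) → ∃ σ₀ : ℝ, 0 < σ₀ ∧ ∀ σ : ℝ, 0 < σ → σ < σ₀ → ∀ (T : ℝ) (ρ θ : ℝ → Literature.MathematicalPhysics.KineticTheory.T3 → ℝ) (u : ℝ → Literature.MathematicalPhysics.KineticTheory.T3 → Literature.MathematicalPhysics.KineticTheory.V3), Literature.MathematicalPhysics.KineticTheory.IsHardSphereEulerSolution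 σ T ρ u θ → ∀ Φ : (N : ℕ) → Literature.Analysis.FluidPDE.HardSphereFlow (Literature.Analysis.FluidPDE.Torus.geometry (Fin 3)) (Literature.MathematicalPhysics.KineticTheory.hsDiameter σ N) (N + 1), Literature.MathematicalPhysics.KineticTheory.TendstoHydroFieldsAt (fun N => Literature.MathematicalPhysics.KineticTheory.localGibbsLaw σ a₀ u₀ θ₀ N (Φ N)) Φ ρ u θ 0 → ∀ t ∈ Set.Ico 0 T, ∀ ε : ℝ, 0 < ε → ∃ M : ℝ, ∃ N₀ : ℕ, ∀ N : ℕ, N₀ ≤ N → ∀ s ∈ Set.Icc 0 t, ∫⁻ z, ENNReal.ofReal (((N : ℝ) + 1)⁻¹ * ∑ i : Fin (N + 1), Set.indicator {v : Literature.MathematicalPhysics.KineticTheory.V3 | M < ‖v‖} (fun v => ‖v‖ ^ 3) (((Φ N).flow s z i).2)) ∂(Literature.MathematicalPhysics.KineticTheory.localGibbsLaw σ a₀ u₀ θ₀ N (Φ N)) ≤ ENNReal.ofReal ε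

/-- item stmt-AtomisticToContinuum-0768 · support · rank 9 · closed · proved by Summit.AtomisticToContinuum.HydrodynamicLimit.Theorems.hsEosLowDensity_proof (prover) · by planner
sources: Ruelle1969, LebowitzPenrose1964
[support] Hard-sphere equation of state at low density: ∃ η₀ > 0 and F real-analytic on (−η₀, η₀)
with hsExcessFreeEnergy = F on [0, η₀), F(0) = 0, F'(0) = 2π/3 (second virial coefficient of
unit-diameter spheres), and the canonical thermodynamic limit −N⁻¹ log hsFreeVolume η N → F(η)
exists (not just limsup) for η ∈ [0, η₀). Ruelle1969 §3.4 (existence), LebowitzPenrose1964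
(convergence of the virial expansion ⇒ analyticity). Makes hsCompressibility/hsPressure smooth and
Z(η) = 1 + (2π/3)η + O(η²); needed by every route (hyperbolicity of the Euler system, virial
theorem). -/
@[route_item "route-AtomisticToContinuum-ExpTailStaging", crux]
def HsEosLowDensity : Prop :=
  ∃ η₀ : ℝ, 0 < η₀ ∧ ∃ F : ℝ → ℝ, AnalyticOnNhd ℝ F (Set.Ioo (-η₀) η₀) ∧ Set.EqOn Literature.MathematicalPhysics.KineticTheory.hsExcessFreeEnergy F (Set.Ico 0 η₀) ∧ F 0 = 0 ∧ deriv F 0 = 2 * Real.pi / 3 ∧ ∀ η ∈ Set.Ico 0 η₀, Filter.Tendsto (fun N : ℕ => -(N : ℝ)⁻¹ * Real.log (Literature.MathematicalPhysics.KineticTheory.hsFreeVolume η N)) Filter.atTop (nhds (F η))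

/-- `HsEosLowDensity` holds: proved by `Summit.AtomisticToContinuum.HydrodynamicLimit.Theorems.hsEosLowDensity_proof`. -/
theorem HsEosLowDensity_holds : HsEosLowDensity := _root_.Summit.AtomisticToContinuum.HydrodynamicLimit.Theorems.hsEosLowDensity_proof

/-- item stmt-AtomisticToContinuum-0769 · support · rank 9 · closed · proved by Summit.AtomisticToContinuum.HydrodynamicLimit.Theorems.heatBathForgetting_assembly_proof @ 7068fd10e358 (prover) · by planner
sources: KipnisLandim1999, OllaVaradhanYau1993
[assembly] X_RE → HydrodynamicLimit: entropy inequality μ(A) ≤ (log 2 + H(μ|λ))/log(1 + 1/λ(A))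
(from Donsker–Varadhan / Mathlib klDiv API) with λ(A) ≤ C e^{-(N+1)/C} and H = o(N) gives μ(A) → 0;
μ = lawAt (Φ N) P t = P.map (flow t) turns μ{z | δ < |field z − ·|} into P{z | δ < |field (flow t z)
− ·|} (measurable_flow); the reference concentration is stated for z itself and TendstoHydroFieldsAt
at time 0 of the reference law is not needed. Zero-mass case impossible by the IsProbabilityMeasure
clauses; take σ₀ from X_RE. -/
@[route_item "route-AtomisticToContinuum-ExpTailStaging", crux]
def EntropyToHydro : Prop :=
  RelEntropyVanishing → Literature.MathematicalPhysics.KineticTheory.HydrodynamicLimit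

/-- `EntropyToHydro` holds: proved by `Summit.AtomisticToContinuum.HydrodynamicLimit.Theorems.heatBathForgetting_assembly_proof` @ 7068fd10e358. -/
theorem EntropyToHydro_holds : EntropyToHydro := _root_.Summit.AtomisticToContinuum.HydrodynamicLimit.Theorems.heatBathForgetting_assembly_proof

/-- item stmt-AtomisticToContinuum-11520 · support · rank 9 · closed · proved by Summit.AtomisticToContinuum.HydrodynamicLimit.Theorems.expTailStaging_expRateGivesCubicUI_proof @ 54e5b389a1ab (planner) · by planner
sources: NachtergaeleYau2003, AlonsoEtAl2013
[support] TAIL LATTICE GLUE (provable now): ExpVelocityMomentBound → EnergyCurrentTails. Given the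
profiles take σ₀ from K1; for σ < σ₀, an Euler solution (unused), flows Φ and t ∈ [0,T) apply K1
with horizon t + 1 to get κ, C, N₀; pointwise |v|³ 𝟙(M < |v|) ≤ g(M) e^(κ|v|) with g(M) = sup_(r>M)
r³e^(-κr) (= M³e^(-κM) for M ≥ 3/κ), so the lintegral is ≤ ofReal(g(M)) · ofReal(C) ≤ ofReal ε for M
large (lintegral monotonicity, no measurability needed). [difficulty: provable-now] -/
@[route_item "route-AtomisticToContinuum-ExpTailStaging"]
def ExpRateGivesCubicUI : Prop :=
  ExpVelocityMomentBound → EnergyCurrentTails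

/-- item stmt-AtomisticToContinuum-11521 · support · rank 9 · open · by planner
sources: Varadhan1993EntropyMethods, NachtergaeleYau2003
[support] SQUEEZE CALCULUS (ii) of the card, negative side, provable now: for θ, β > 0, the
Maxwellian weight integrates exp((γv³)^(1/β) − v²/(2θ)) on (0,∞) for EVERY γ > 0 iff β > 3/2 (β =
3/2 fails for γ^(2/3) ≥ 1/(2θ); β < 3/2 fails for all γ) — the Orlicz conjugate exp(y^(1/β)) of f =
M·(log M)^β closes a cubic observable against a Maxwellian exactly in the super-KL regime β > 3/2,
where the one-fast-sphere pinch takes over (informal DivergenceClassNoGo). Documents why no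
divergence choice removes the need for K1. [difficulty: provable-now] -/
@[route_item "route-AtomisticToContinuum-ExpTailStaging"]
def OrliczCubicThreshold : Prop :=
  ∀ θ β : ℝ, 0 < θ → 0 < β → ((∀ γ : ℝ, 0 < γ → MeasureTheory.IntegrableOn (fun v : ℝ => Real.exp ((γ * v ^ 3) ^ (1 / β) - v ^ 2 / (2 * θ))) (Set.Ioi 0)) ↔ 3 / 2 < β)

/-- item stmt-AtomisticToContinuum-11522 · support · rank 9 · open · by planner
sources: Varadhan1993EntropyMethods, KipnisLandim1999
[support] SQUEEZE CALCULUS (v) of the card, provable now: for every variance θ > 0, entropy budget h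
> 0 and level K there is a probability measure p on ℝ with klDiv(p ‖ N(0,θ)) ≤ h and ∫|v|³ dp ≥ K
(mixture (1−q)N(0,θ) + q·Unif[V,V+1] with q ≍ 2θh/V²: cubic moment ≍ 2θhV → ∞). The one-line reason
K1 cannot come from relative-entropy bookkeeping against the invariant Gibbs law and must be a
dynamical input. [difficulty: provable-now] -/
@[route_item "route-AtomisticToContinuum-ExpTailStaging"]
def EntropyBlindToCubicMoments : Prop :=
  ∀ θ : NNReal, 0 < θ → ∀ h K : ℝ, 0 < h → ∃ p : MeasureTheory.Measure ℝ, MeasureTheory.IsProbabilityMeasure p ∧ InformationTheory.klDiv p (ProbabilityTheory.gaussianReal 0 θ) ≤ ENNReal.ofReal h ∧ ENNReal.ofReal K ≤ ∫⁻ v, ENNReal.ofReal (|v| ^ 3) ∂p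

-- item stmt-AtomisticToContinuum-11538 · support · rank 9 · open · by planner — informal only, no Lean statement yet:
--   [support] MESOSCOPIC PRESSURE FUNCTIONAL / LARGE-DEVIATION UPPER BOUND FOR DILUTE LOCAL GIBBS LAWS
--   AT BLOCK SCALE (the equilibrium input of StagedEntropyGronwall step (iv) beyond
--   LocalGibbsConcentration 9246; informal until the planner or a grounder types it over Torus.kernel):
--   for continuous profiles (a, u, θ), σ < σ₀, α ∈ (0, 1/3), h_N = (N+1)^(-α), and every bounded
--   continuous G : 𝕋³ × (ℝ × ℝ³ × ℝ) → ℝ, limsup_N (N+1)⁻¹ log E_{localGibbsLaw σ a u θ N Φ} exp( (N+1)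
--   ∫_{𝕋³} G(x, U_h(z)(x)) dx ) ≤ ∫_{𝕋³} sup_U [ G(x, U) − I_x(U) ] dx, where U_h = (ρ_h, m_h, e_h) are
--   the Torus.kernel-h_N-mollifi

/-- item stmt-AtomisticToContinuum-11539 · support · rank 9 · open · by planner
[support] DIVERGENCE-CLASS NO-GO — THE ONE-FAST-SPHERE PINCH (card
yau-exponent-forced-divergence-squeeze-v2, squeeze (iii); NEGATIVE SIDE, not on the deciding path;
informal until the definition request fDiv lands): for a Maxwellian reference ψ = N(u, θ𝟙) on ℝ³,
the cubic energy-current observable Z(w) = b·w |w|²/2 (b = ∇β ≠ 0, w = v − u), and g(M) = M·(log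
M)^β with β ≥ 3/2 (super-KL divergences D_g(Q‖ψ) = E_ψ g(dQ/dψ)), for every budget D > 0: sup { E_Q
Z − E_ψ Z : Q ≪ ψ, D_g(Q‖ψ) ≤ D } ≥ c ‖b‖ (2θ)^(3/2) D^(3/(2β)) (exhibit the tilt putting mass q on
the shell |w| ≈ V = (2θ)^(1/2) D^(1/(2β)), q = 1), and = +∞ for β < 3/2 (V → ∞; cf.
OrliczCubicThreshold); since D_g ≥ H^β by Jensen (H = KL), any certificate for E_{P_t} Z that uses
only a divergence value D_g(P_t‖ψ_t) ≤ D and the ψ_t-law of Z injects ≥ c H^(3/2) per unit time,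
β-independently — the formal reason the door of this route is a bound on the TRUE law
(ExpVelocityMomentBound) and not a cleverer divergence. Why it might fail: the N-body version must
place the fast sphere on the exact energy shell of the canonical local Gibbs law (k spheres at speed
V with kV² = N^(1−ε)); the one-particle statement above is elementary. So -/
@[route_item "route-AtomisticToContinuum-ExpTailStaging"]
def DivergenceClassNoGo : Prop :=
  (∀ β : ℝ, 3 / 2 ≤ β → ∃ c : ℝ, 0 < c ∧ ∀ (θ : ℝ), 0 < θ → ∀ (u b : EuclideanSpace ℝ (Fin 3)), b ≠ 0 → ∀ D : ℝ, 0 < D → ∃ Q : MeasureTheory.Measure (EuclideanSpace ℝ (Fin 3)), MeasureTheory.IsProbabilityMeasure Q ∧ Q.AbsolutelyContinuous (ProbabilityTheory.multivariateGaussian u (θ • (1 : Matrix (Fin 3) (Fin 3) ℝ))) ∧ Literature.Probability.Divergences.fDiv (fun x : ℝ => x * |Real.log x| ^ β) Q (ProbabilityTheory.multivariateGaussian u (θ • (1 : Matrix (Fin 3) (Fin 3) ℝ))) ≤ ENNReal.ofReal D ∧ MeasureTheory.Integrable (fun v : EuclideanSpace ℝ (Fin 3) => inner ℝ b (v - u)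 * ‖v - u‖ ^ 2 / 2) Q ∧ c * ‖b‖ * (2 * θ) ^ (3 / 2 : ℝ) * D ^ (3 / (2 * β)) ≤ (∫ v, inner ℝ b (v - u) * ‖v - u‖ ^ 2 / 2 ∂Q) - ∫ v, inner ℝ b (v - u) * ‖v - u‖ ^ 2 / 2 ∂(ProbabilityTheory.multivariateGaussian u (θ • (1 : Matrix (Fin 3) (Fin 3) ℝ)))) ∧ (∀ β : ℝ, 0 < β → β < 3 / 2 → ∀ (θ : ℝ), 0 < θ → ∀ (u b : EuclideanSpace ℝ (Fin 3)), b ≠ 0 → ∀ D : ℝ, 0 < D → ∀ K : ℝ, ∃ Q : MeasureTheory.Measure (EuclideanSpace ℝ (Fin 3)), MeasureTheory.IsProbabilityMeasure Q ∧ Q.AbsolutelyContinuous (ProbabilityTheory.multivariateGaussian u (θ • (1 : Matrix (Fin 3) (Fin 3) ℝ))) ∧ Literature.Probability.Divergences.fDiv (fun x : ℝ => x * |Real.log x| ^ β) Q (ProbabilityTheory.multivariateGaussian u (θ • (1 : Matrix (Fin 3) (Fin 3) ℝ))) ≤ ENNReal.ofReal D ∧ MeasureTheory.Integrable (fun v :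 EuclideanSpace ℝ (Fin 3) => inner ℝ b (v - u) * ‖v - u‖ ^ 2 / 2) Q ∧ K ≤ (∫ v, inner ℝ b (v - u) * ‖v - u‖ ^ 2 / 2 ∂Q) - ∫ v, inner ℝ b (v - u) * ‖v - u‖ ^ 2 / 2 ∂(ProbabilityTheory.multivariateGaussian u (θ • (1 : Matrix (Fin 3) (Fin 3) ℝ))))

/-- item stmt-AtomisticToContinuum-9246 · support · rank 9 · closed · proved by Summit.AtomisticToContinuum.HydrodynamicLimit.Theorems.heatBathForgetting_localGibbsConcentration_proof @ d87eea47b023 (prover) · by planner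
sources: Ruelle1969, LebowitzPenrose1964
[support] exponential law of large numbers for canonical local Gibbs states at small reduced density
(shared item stmt-AtomisticToContinuum-0767, same signature; low-density cluster expansion).
[difficulty: M] -/
@[route_item "route-AtomisticToContinuum-ExpTailStaging", crux]
def LocalGibbsConcentration : Prop :=
  ∀ (a θ₀ : Literature.MathematicalPhysics.KineticTheory.T3 → ℝ) (u₀ : Literature.MathematicalPhysics.KineticTheory.T3 → Literature.MathematicalPhysics.KineticTheory.V3), Continuous a → Continuous θ₀ → Continuous u₀ → (∀ x, 0 < a x) → (∀ x, 0 < θ₀ x) → ∃ σ₀ : ℝ, 0 < σ₀ ∧ ∀ σ : ℝ, 0 < σ → σ < σ₀ → ∃ ρ₀ : Literature.MathematicalPhysics.KineticTheory.T3 → ℝ, Continuous ρ₀ ∧ (∀ x, 0 < ρ₀ x) ∧ (∀ (N : ℕ) (Φ : Literature.Analysis.FluidPDE.HardSphereFlow (Literature.Analysis.FluidPDE.Torus.geometry (Fin 3)) (Literature.MathematicalPhysics.KineticTheory.hsDiameter σ N) (N + 1)), MeasureTheory.IsProbabilityMeasure (Literature.MathematicalPhysics.KineticTheory.localGibbsLaw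 σ a u₀ θ₀ N Φ)) ∧ ∀ χ : Literature.MathematicalPhysics.KineticTheory.T3 → ℝ, Continuous χ → ∀ δ : ℝ, 0 < δ → ∃ C : ℝ, 0 < C ∧ ∀ (N : ℕ) (Φ : Literature.Analysis.FluidPDE.HardSphereFlow (Literature.Analysis.FluidPDE.Torus.geometry (Fin 3)) (Literature.MathematicalPhysics.KineticTheory.hsDiameter σ N) (N + 1)), Literature.MathematicalPhysics.KineticTheory.localGibbsLaw σ a u₀ θ₀ N Φ {z | δ < |Literature.MathematicalPhysics.KineticTheory.empiricalDensityField z χ - ∫ x, χ x * ρ₀ x|} ≤ ENNReal.ofReal (C * Real.exp (-(C⁻¹ * (N + 1)))) ∧ Literature.MathematicalPhysics.KineticTheory.localGibbsLaw σ a u₀ θ₀ N Φ {z | δ < ‖Literature.MathematicalPhysics.KineticTheory.empiricalMomentumField z χ - ∫ x, (χ x * ρ₀ x) • u₀ x‖} ≤ ENNReal.ofReal (C * Real.exp (-(C⁻¹ * (N + 1)))) ∧ Literature.MathematicalPhysics.KineticTheory.localGibbsLaw σ a u₀ θ₀ N Φ {z | δ < |Literature.MathematicalPhysics.KineticTheory.empiricalEnergyField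 z χ - ∫ x, χ x * Literature.MathematicalPhysics.KineticTheory.totalEnergyDensity (ρ₀ x) (u₀ x) (θ₀ x)|} ≤ ENNReal.ofReal (C * Real.exp (-(C⁻¹ * (N + 1))))

/-- `LocalGibbsConcentration` holds: proved by `Summit.AtomisticToContinuum.HydrodynamicLimit.Theorems.heatBathForgetting_localGibbsConcentration_proof` @ d87eea47b023. -/
theorem LocalGibbsConcentration_holds : LocalGibbsConcentration := _root_.Summit.AtomisticToContinuum.HydrodynamicLimit.Theorems.heatBathForgetting_localGibbsConcentration_proof

/-- item stmt-AtomisticToContinuum-11523 · assembly · rank 1 · open · by planner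
sources: KipnisLandim1999, OllaVaradhanYau1993, NachtergaeleYau2003
[assembly] ExpVelocityMomentBound → MesoFluxClosure → StagedEntropyGronwall →
LocalGibbsConcentration → HsEosLowDensity → EntropyToHydro → HydrodynamicLimit (the chain of
`closes`; conclusion = the sub-problem Statement decl). -/
@[route_item "route-AtomisticToContinuum-ExpTailStaging"]
def Assembly : Prop :=
  ExpVelocityMomentBound → MesoFluxClosure → StagedEntropyGronwall → LocalGibbsConcentration → HsEosLowDensity → EntropyToHydro → HydrodynamicLimit

/-! D-0027 §2.1 — DECIDING THEOREM (planner-authored via `route open/edit --closes-file`; by planner-rrepair-AtomisticToContinuum-ExpTailSt-2f6c5bb7-0 2026-08-16T23:10:10Z):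
its hypotheses are this route's items and its conclusion the sub-problem Statement (glue_lint), and it elaborates with this file. -/

/-- D-0027 §2.1 deciding theorem of route ExpTailStaging (pure logic): the staging lemma fed with the
mesoscopic flux closure, the exponential velocity-moment rate and the two statics gives Yau's entropy
form `RelEntropyVanishing`; the entropy-inequality glue `EntropyToHydro` (shared item, stated over the
Literature decl) yields the UNGUARDED Literature conjecture
`Literature.MathematicalPhysics.KineticTheory.HydrodynamicLimit`, which implies the packing-guarded
sub-problem Statement (re-typed 2026-08-16, p126922) by `HydrodynamicLimit.of_unguarded` (take any
threshold, ignore the guard): the route proves the stronger unguarded form, so the new conjunct's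
packing guard is supplied for free. -/
@[closes "route-AtomisticToContinuum-ExpTailStaging"] theorem closes (h₁ : ExpVelocityMomentBound) (h₂ : MesoFluxClosure) (h₃ : StagedEntropyGronwall)
    (h₄ : LocalGibbsConcentration) (h₅ : HsEosLowDensity) (h₆ : EntropyToHydro) :
    _root_.HydrodynamicLimit :=
  _root_.HydrodynamicLimit.of_unguarded (h₆ (h₃ h₂ h₁ h₄ h₅))

end Summit.AtomisticToContinuum.HydrodynamicLimit.Theses.ExpTailStaging
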